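import Summits.HodgeConjecture.HodgeConjecture.Theorems.Ring2WeilCoverageTwistedUnitWitnesses
import Summits.HodgeConjecture.HodgeConjecture.Theorems.Ring2WeilCoverageCyclotomicTwistedObstruction
import Summits.HodgeConjecture.HodgeConjecture.Theorems.Ring2WeilCoverageCyclotomicUnitProducts
import HarnessLib

/-!
# Weil-type family coverage — the census level `M = 56`, YES direction: the twisted unit supply of `ℚ(ζ₅₆)⁺` by
# twenty `decide`d witnesses, and «`n₊₋(Φ)` ODD ⇒ principally polarisable» at `(56, ℚ(i))`, `(56, ℚ(√−2))`,
# «`n₊₋(Φ)` EVEN ⇒ principally polarisable» at `(56, ℚ(√−7))`, `(56, ℚ(√−14))` — hypothesis-free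

research route conditional on HC_CM; not a corollary; Q11.4-sentence-2 already refuted in dim ≥ 3.

Ring 2, WEIL-TYPE FAMILY-COVERAGE CENSUS (`HOME/WEIL-FAMILY-COVERAGE.md` `## b01`, block b01.25 (A): «`M = 56`:
`K = ℚ(i), ℚ(√−2)`: `A_Φ` principal ⟺ `n₊₋(Φ)` ODD; `K = ℚ(√−7), ℚ(√−14)`: ⟺ EVEN — 260/260 classes»; owner
ring2-b01), part 39 of the `Ring2WeilCoverage*` series — the YES half at `56` (part 37 did the NO half), by part 38
(`…TwistedUnitWitnesses`: same-class pair witnesses ⇒ every sign pattern with even weight on both classes of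
places ⇒ principal polarisation) instantiated with part 13's units `u(a,b,h) = ζ^h(1 − ζ^a)(1 − ζ^b)`, whose sign
vectors have rank `10 = 12 − 2` at `56` (the full signature group, b01.25 (A)):

* §1 `familyProperty_fiftySix` (part 13's units as a family in the sense of part 21).
* §2 **`witnessTable_fiftySix_plus` / `_minus`** (`decide +kernel`): for every unit residue `s` of the class
  `C₊ = {χ₈ = +1}` other than `±1`, resp. of `C₋ = {χ₈ = −1}` other than `±3`, an explicit signed product of
  admissible `u(1,b,h)` is negative exactly at `{±1, ±s}` resp. `{±3, ±s}` (20 witnesses, `g59/py/witness56.py`);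
  `pairProperty_fiftySix`: every same-class pair is a pattern.
* §3 **`exists_principal_fiftySix_of_even_on`**: for ANY CM type `Φ` of a cyclotomic CM field `K ⊇ ℚ(ζ₅₆)` with
  `|S_Φ ∩ C₊ ∩ N_odd|` and `|S_Φ ∩ C₋ ∩ N_odd|` BOTH EVEN, `ℂ^Φ/Φ(ℤ[ζ₅₆])` CARRIES an `ι`-compatible principal
  polarisation — with part 37: **principal ⟺ both twisted counts even**, hypothesis-free.
* §4 the census rows (`Φ` `K`-balanced, `|S_Φ ∩ N_K| = 6`): `row_parities` (bookkeeping through part 35's twisted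
  pair count), **`exists_principal_fiftySix_sqrt_neg_one`** (`K = ℚ(i)`: `n₊₋(Φ) = |S_Φ ∩ {15,23,31,39,47,55}|` ODD
  ⇒ YES) and **`exists_principal_fiftySix_sqrt_neg_seven`** (`K = ℚ(√−7)`: `n₊₋(Φ) = |S_Φ ∩ {17,31,33,41,47,55}|`
  EVEN ⇒ YES), and the same for **`…_sqrt_neg_two`** (ODD ⇒ YES) and **`…_sqrt_neg_fourteen`** (EVEN ⇒ YES):
  all of b01.25 (A)'s YES classes at `56` (472 + 472 + 452 + 452), kernel, no PARI.

HONEST FRAMING: statements about Shimura's divisors of principal type on `ℂ^Φ/Φ(ℤ[ζ₅₆])` (principal lattice); nothing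
about Hodge classes, `W_K`, general members or HC; `HC_CM` nowhere.  No `def`, no named fact, no `sorry`.  References:
[cite: Shimura1998, §14.3 Prop. 4–5, pp. 103–104]; [cite: Washington1997, §8.1]; census b01.25 (A) (seat-derived).
-/

noncomputable section

open Polynomial NumberField Complex Finset
open scoped Real nonZeroDivisors

namespace Summit.HodgeConjecture.Ring2WeilCoverage.CyclotomicTwistedLevel56Yes

open Literature.AlgebraicGeometry.Motives (CMType)
open Literature.AlgebraicGeometry.HodgeTheory (IsCMTypeSet)
open Literature.AlgebraicGeometry.ComplexMultiplication.CyclotomicCMType (isCMTypeSet_residueFilter)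
open Literature.NumberTheory.ComplexMultiplication
open Summit.HodgeConjecture.Ring2WeilCoverage.TwistedUnitWitnesses
open Summit.HodgeConjecture.Ring2WeilCoverage.CyclotomicTwistedObstruction (card_inter_mod_two_eq_on)
open Summit.HodgeConjecture.Ring2WeilCoverage.CyclotomicUnitProducts (exists_units_coe_eq re_embedding_prod_neg_iff)
open Summit.HodgeConjecture.Ring2WeilCoverage.CMTypeSetOddPositions (two_mul_card_eq_card_units)

variable {K : Type} [Field K] [NumberField K] {ζ : K}

/-- `𝐞(t) = exp(2πi t/56) ∈ ℂ` (`ZMod.toCircle`). -/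
local notation3 (prettyPrint := false) "𝐞 " t:max => ((ZMod.toCircle t : Circle) : ℂ)

/-- the sign predicate of part 13's `u(a,b,h) = ζ^h(1 − ζ^a)(1 − ζ^b)` at the unit residue `t`. -/
local notation3 (prettyPrint := false) "negAt" =>
  (fun (x : ℕ × ℕ × ℕ) (t : ZMod 56) => (56 < x.1 * ZMod.val t % (2 * 56) ↔ 56 < x.2.1 * ZMod.val t % (2 * 56)))

/-- admissibility of a triple `x = (a, b, h)` (part 13). -/
local notation3 (prettyPrint := false) "Adm" =>
  (fun x : ℕ × ℕ × ℕ => ¬ 56 ∣ x.1 ∧ ¬ 56 ∣ x.2.1 ∧ (2 * x.2.2 + x.1 + x.2.1) % (2 * 56) = 0 ∧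
    ¬ IsPrimePow (56 / Nat.gcd 56 x.1) ∧ ¬ IsPrimePow (56 / Nat.gcd 56 x.2.1))

/-- the sign pattern of the signed product `(A, ε)` at `t`. -/
local notation3 (prettyPrint := false) "pat " A:max ε:max t:max =>
  Odd ((Finset.filter (fun x : ℕ × ℕ × ℕ => negAt x t) A).card + (if (ε : Bool) then 1 else 0))

/-- The census's set `N_odd` at `56` (unit residues at odd positions), as a filter. -/
local notation3 (prettyPrint := false) "Nodd" =>
  (Finset.univ.filter fun t : ZMod 56 => t.val.Coprime 56 ∧
    Even (Finset.card (Finset.filter (fun s : ZMod 56 => s.val.Coprime 56 ∧ s.val < t.val) Finset.univ)))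

/-- the class `C₊ = {t : χ₈(t) = +1}` of unit residues mod `56`. -/
local notation3 (prettyPrint := false) "Cp" => ({1, 9, 15, 17, 23, 25, 31, 33, 39, 41, 47, 55} : Finset (ZMod 56))

/-- the class `C₋ = {t : χ₈(t) = −1}` of unit residues mod `56`. -/
local notation3 (prettyPrint := false) "Cm" => ({3, 5, 11, 13, 19, 27, 29, 37, 43, 45, 51, 53} : Finset (ZMod 56))

/-! ### §1 Part 13's units as a family; §2 the twenty witnesses (`g59/py/witness56.py`) -/

/-- **The family property of part 21 for part 13's units at level 56**: admissible signed products of the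
`ζ^h(1 − ζ^a)(1 − ζ^b)` are units of `𝓞 K` fixed by `ρ` with the sign law `negAt`.
research route conditional on HC_CM; not a corollary; Q11.4-sentence-2 already refuted in dim ≥ 3. [cite: Washington1997, §8.1] -/
theorem familyProperty_fiftySix [IsCMField K] (hζ : IsPrimitiveRoot ζ 56) :
    ∀ A : Finset (ℕ × ℕ × ℕ), (∀ x ∈ A, Adm x) → ∀ ε : Bool,
      ∃ u : (𝓞 K)ˣ, IsCMField.complexConj K ((u : 𝓞 K) : K) = ((u : 𝓞 K) : K) ∧
        ∀ (φ : K →+* ℂ) (t : ZMod 56), φ ζ = 𝐞 t → t.val.Coprime 56 →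
          (((φ ((u : 𝓞 K) : K)).re < 0) ↔ pat A ε t) := by
  intro A hA ε
  obtain ⟨u, hu, hconj⟩ := exists_units_coe_eq hζ hA ε
  refine ⟨u, hconj, fun φ t hφt ht => ?_⟩
  rw [hu]
  have hA' : ∀ x ∈ A, ¬ 56 ∣ x.1 ∧ ¬ 56 ∣ x.2.1 ∧ (2 * x.2.2 + x.1 + x.2.1) % (2 * 56) = 0 := fun x hx =>
    ⟨(hA x hx).1, (hA x hx).2.1, (hA x hx).2.2.1⟩
  exact (re_embedding_prod_neg_iff hφt ht A hA' ε).1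

/-- **Witness table, class `C₊` (base `1`)** (`decide`): for every unit residue `s ∈ C₊`, `s ≠ ±1`, the listed
signed product of admissible `u(1,b,h)` is negative exactly at `{±1, ±s}`.
research route conditional on HC_CM; not a corollary; Q11.4-sentence-2 already refuted in dim ≥ 3. [folklore] -/
theorem witnessTable_fiftySix_plus :
    ∀ s ∈ (Finset.univ.filter fun s : ZMod 56 => s.val.Coprime 56 ∧ s ∈ Cp ∧ s ≠ 1 ∧ s ≠ -1),
      ∃ w ∈ ({
    (9, {(1, 3, 54), (1, 5, 53), (1, 17, 47), (1, 25, 43)}, true),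
    (15, {(1, 3, 54), (1, 5, 53), (1, 9, 51), (1, 13, 49), (1, 25, 43)}, false),
    (17, {(1, 5, 53), (1, 17, 47), (1, 23, 44)}, false),
    (23, {(1, 9, 51), (1, 17, 47), (1, 27, 42)}, false),
    (25, {(1, 11, 50), (1, 15, 48), (1, 27, 42)}, false),
    (31, {(1, 11, 50), (1, 15, 48), (1, 27, 42)}, false),
    (33, {(1, 9, 51), (1, 17, 47), (1, 27, 42)}, false),
    (39, {(1, 5, 53), (1, 17, 47), (1, 23, 44)}, false),
    (41, {(1, 3, 54), (1, 5, 53), (1, 9, 51), (1, 13, 49), (1, 25, 43)}, false),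
    (47, {(1, 3, 54), (1, 5, 53), (1, 17, 47), (1, 25, 43)}, true)} :
      Finset (ZMod 56 × Finset (ℕ × ℕ × ℕ) × Bool)),
        w.1 = s ∧ (∀ x ∈ w.2.1, Adm x) ∧
          ∀ t ∈ (Finset.univ.filter fun t : ZMod 56 => t.val.Coprime 56),
            (pat w.2.1 w.2.2 t ↔ (t = 1 ∨ t = -1 ∨ t = s ∨ t = -s)) := by
  decide +kernel

/-- **Witness table, class `C₋` (base `3`)** (`decide`): for every unit residue `s ∈ C₋`, `s ≠ ±3`, the listed signed
product of admissible `u(1,b,h)` is negative exactly at `{±3, ±s}`.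
research route conditional on HC_CM; not a corollary; Q11.4-sentence-2 already refuted in dim ≥ 3. [folklore] -/
theorem witnessTable_fiftySix_minus :
    ∀ s ∈ (Finset.univ.filter fun s : ZMod 56 => s.val.Coprime 56 ∧ s ∈ Cm ∧ s ≠ 3 ∧ s ≠ -3),
      ∃ w ∈ ({
    (5, {(1, 3, 54), (1, 5, 53), (1, 17, 47), (1, 27, 42)}, false),
    (11, {(1, 3, 54), (1, 17, 47), (1, 19, 46), (1, 23, 44), (1, 27, 42)}, true),
    (13, {(1, 3, 54), (1, 9, 51), (1, 13, 49), (1, 19, 46)}, false),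
    (19, {(1, 5, 53), (1, 9, 51), (1, 15, 48), (1, 19, 46)}, false),
    (27, {(1, 13, 49), (1, 17, 47), (1, 27, 42)}, true),
    (29, {(1, 13, 49), (1, 17, 47), (1, 27, 42)}, true),
    (37, {(1, 5, 53), (1, 9, 51), (1, 15, 48), (1, 19, 46)}, false),
    (43, {(1, 3, 54), (1, 9, 51), (1, 13, 49), (1, 19, 46)}, false),
    (45, {(1, 3, 54), (1, 17, 47), (1, 19, 46), (1, 23, 44), (1, 27, 42)}, true),
    (51, {(1, 3, 54), (1, 5, 53), (1, 17, 47), (1, 27, 42)}, false)} :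
      Finset (ZMod 56 × Finset (ℕ × ℕ × ℕ) × Bool)),
        w.1 = s ∧ (∀ x ∈ w.2.1, Adm x) ∧
          ∀ t ∈ (Finset.univ.filter fun t : ZMod 56 => t.val.Coprime 56),
            (pat w.2.1 w.2.2 t ↔ (t = 3 ∨ t = -3 ∨ t = s ∨ t = -s)) := by
  decide +kernel

/-- Class facts at `56` (`decide`): units outside `C₊` = `C₋`; both symmetric; `1 ∈ C₊`, `3 ∉ C₊`. [folklore] -/
theorem classFacts_fiftySix :
    (∀ t : ZMod 56, t.val.Coprime 56 → (t ∉ Cp ↔ t ∈ Cm)) ∧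
    (∀ t : ZMod 56, t.val.Coprime 56 → (-t ∈ Cp ↔ t ∈ Cp)) ∧
    (∀ t ∈ Cm, -t ∈ Cm) ∧ (∀ t ∈ Cp, -t ∈ Cp) ∧ (1 : ZMod 56) ∈ Cp ∧ (3 : ZMod 56) ∉ Cp ∧
    (3 : ZMod 56).val.Coprime 56 ∧ (1 : ZMod 56).val.Coprime 56 := by
  refine ⟨by decide, by decide, by decide, by decide, by decide, by decide, by decide, by decide⟩

/-- **The same-class pair property at `56`** for part 13's units and the class `C₊`: every two unit residues of the
same `χ₈`-class, not equal or opposite, carry a signed product negative exactly at `{±t₁, ±t₂}` (part 38's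
`pairs_on_of_base` off the bases `1 ∈ C₊` and `3 ∈ C₋`).
research route conditional on HC_CM; not a corollary; Q11.4-sentence-2 already refuted in dim ≥ 3. [folklore] -/
theorem pairProperty_fiftySix :
    ∀ t₁ t₂ : ZMod 56, t₁.val.Coprime 56 → t₂.val.Coprime 56 → (t₁ ∈ Cp ↔ t₂ ∈ Cp) → t₂ ≠ t₁ → t₂ ≠ -t₁ →
      ∃ A : Finset (ℕ × ℕ × ℕ), ∃ ε : Bool, (∀ x ∈ A, Adm x) ∧
        ∀ t : ZMod 56, t.val.Coprime 56 → (pat A ε t ↔ (t = t₁ ∨ t = -t₁ ∨ t = t₂ ∨ t = -t₂)) := by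
  obtain ⟨hcompl, hCsym, -, -, h1, h3, h3u, h1u⟩ := classFacts_fiftySix
  intro t₁ t₂ h₁ h₂ hcls hne hne'
  by_cases hc : t₁ ∈ Cp
  · -- class `C₊`, base `1`
    refine pairs_on_of_base negAt Adm Cp (b := 1) hCsym ?_ h₁ h₂ (by simp [hc, h1]) (by simp [hcls.mp hc, h1])
      hne hne'
    intro s hs hsc hs1 hs2
    have hsC : s ∈ Cp := by simpa [h1] using hsc
    obtain ⟨w, -, rfl, hA, hP⟩ :=
      witnessTable_fiftySix_plus s (Finset.mem_filter.mpr ⟨Finset.mem_univ _, hs, hsC, hs1, hs2⟩)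
    exact ⟨w.2.1, w.2.2, hA, fun t ht => hP t (Finset.mem_filter.mpr ⟨Finset.mem_univ _, ht⟩)⟩
  · -- class `C₋`, base `3`
    have hc₂ : t₂ ∉ Cp := fun h => hc (hcls.mpr h)
    refine pairs_on_of_base negAt Adm Cp (b := 3) hCsym ?_ h₁ h₂ (by simp [hc, h3]) (by simp [hc₂, h3]) hne hne'
    intro s hs hsc hs1 hs2
    have hsC : s ∈ Cm := (hcompl s hs).mp (by simpa [h3] using hsc)
    obtain ⟨w, -, rfl, hA, hP⟩ :=
      witnessTable_fiftySix_minus s (Finset.mem_filter.mpr ⟨Finset.mem_univ _, hs, hsC, hs1, hs2⟩)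
    exact ⟨w.2.1, w.2.2, hA, fun t ht => hP t (Finset.mem_filter.mpr ⟨Finset.mem_univ _, ht⟩)⟩

/-! ### §3 The YES verdict at `56` from the two twisted parities; §4 the census rows -/

open scoped Classical in
/-- **THE TWISTED YES VERDICT AT `M = 56` (no hypothesis beyond the two parities).**  For any `K` with
`IsCyclotomicExtension {56} ℚ K`, `[IsCMField K]`, `ζ` a primitive 56th root and ANY CM type `Φ`: if
`λ₊ = |S_Φ ∩ N_odd ∩ C₊|` and `λ₋ = |S_Φ ∩ N_odd ∩ C₋|` are BOTH EVEN (stated as the two filters of `S_Φ ∩ N_odd` by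
`· ∈ C₊` / `· ∉ C₊`), then `ℂ^Φ/Φ(ℤ[ζ₅₆])` CARRIES an `ι`-compatible principal polarisation.  With part 37
(`λ₊` or `λ₋` odd ⇒ NO) the principal polarisability of `ℂ^Φ/Φ(ℤ[ζ₅₆])` is DECIDED for all `2¹²` CM types.
research route conditional on HC_CM; not a corollary; Q11.4-sentence-2 already refuted in dim ≥ 3. [cite: Shimura1998, §14.3 Prop. 5, p. 104] -/
theorem exists_principal_fiftySix_of_even_on [IsCMField K] [IsCyclotomicExtension {56} ℚ K]
    (hζ : IsPrimitiveRoot ζ 56) (Φ : CMType K)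
    (hevC : Even (((Finset.univ.filter fun t : ZMod 56 => ∃ σ ∈ Φ.1, σ ζ = 𝐞 t) ∩ Nodd).filter
      fun t => t ∈ Cp).card)
    (hevC' : Even (((Finset.univ.filter fun t : ZMod 56 => ∃ σ ∈ Φ.1, σ ζ = 𝐞 t) ∩ Nodd).filter
      fun t => t ∉ Cp).card) :
    ∃ ζ' : K, IsCMField.complexConj K ζ' = -ζ' ∧ (∀ φ : Φ.1, 0 < (φ.1 ζ').im) ∧
        CMTypeLattice.IsOfType (1 : (FractionalIdeal (𝓞 K)⁰ K)ˣ) ζ' ⊤ := by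
  have hg : Nat.totient 56 = 2 * (11 + 1) := by decide
  exact exists_principal_of_pairs_on negAt Adm Cp hζ hg (familyProperty_fiftySix hζ) pairProperty_fiftySix
    classFacts_fiftySix.2.1 Φ hevC hevC'

/-- **Row bookkeeping (YES side)**, every level: `S` a CM type set, classes `C₊ ⊔ C₋ =` units (both symmetric), `N_odd`,
`N_K` CM type sets, `E± = C± ∩ N_K`: `λ± ≡ |S ∩ E±| + |C± ∩ (N_odd ∖ N_K)|` and `|S ∩ E₊| + |S ∩ E₋| = |S ∩ N_K|`.
research route conditional on HC_CM; not a corollary; Q11.4-sentence-2 already refuted in dim ≥ 3. [folklore] -/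
theorem row_parities {m : ℕ} [NeZero m] {S Cp' Cm' NoddE NK Ep Em : Finset (ZMod m)} (hS : IsCMTypeSet m S)
    (hNodd : IsCMTypeSet m NoddE) (hNK : IsCMTypeSet m NK) (hcompl : ∀ t : ZMod m, t.val.Coprime m → (t ∉ Cp' ↔ t ∈ Cm'))
    (hCp : ∀ t ∈ Cp', -t ∈ Cp') (hCm : ∀ t ∈ Cm', -t ∈ Cm') (hEp : Cp' ∩ NK = Ep) (hEm : Cm' ∩ NK = Em)
    (hunion : Ep ∪ Em = NK) (hdisj : Disjoint Ep Em) :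
    ((S ∩ NoddE).filter fun t => t ∈ Cp').card % 2 = ((S ∩ Ep).card + (Cp' ∩ (NoddE \ NK)).card) % 2 ∧
    ((S ∩ NoddE).filter fun t => t ∉ Cp').card % 2 = ((S ∩ Em).card + (Cm' ∩ (NoddE \ NK)).card) % 2 ∧
    (S ∩ Ep).card + (S ∩ Em).card = (S ∩ NK).card := by
  have h1 : ((S ∩ NoddE).filter fun t => t ∈ Cp') = S ∩ Cp' ∩ NoddE := by
    ext t; simp only [mem_filter, mem_inter]; tauto
  have h2 : ((S ∩ NoddE).filter fun t => t ∉ Cp') = S ∩ Cm' ∩ NoddE := by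
    ext t
    simp only [mem_filter, mem_inter]
    constructor
    · rintro ⟨⟨htS, htN⟩, htC⟩
      exact ⟨⟨htS, (hcompl t (hS.1 t htS)).mp htC⟩, htN⟩
    · rintro ⟨⟨htS, htC⟩, htN⟩
      exact ⟨⟨htS, htN⟩, (hcompl t (hS.1 t htS)).mpr htC⟩
  refine ⟨?_, ?_, ?_⟩
  · rw [h1, card_inter_mod_two_eq_on hS hNodd hNK hCp, Finset.inter_assoc, hEp]
  · rw [h2, card_inter_mod_two_eq_on hS hNodd hNK hCm, Finset.inter_assoc, hEm]
  · rw [← Finset.card_union_of_disjoint (Finset.disjoint_of_subset_left Finset.inter_subset_right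
      (Finset.disjoint_of_subset_right Finset.inter_subset_right hdisj)), ← Finset.inter_union_distrib_left,
      hunion]

/-- Row data at `56` (`decide`): `N_odd`, `N_K` (`K = ℚ(i)`, `ℚ(√−7)`), `E± = C± ∩ N_K`, the constants. [folklore] -/
theorem rowData_fiftySix :
    IsCMTypeSet 56 Nodd ∧
    (IsCMTypeSet 56 ({3, 11, 15, 19, 23, 27, 31, 39, 43, 47, 51, 55} : Finset (ZMod 56)) ∧
      Cp ∩ ({3, 11, 15, 19, 23, 27, 31, 39, 43, 47, 51, 55} : Finset (ZMod 56)) = {15, 23, 31, 39, 47, 55} ∧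
      Cm ∩ ({3, 11, 15, 19, 23, 27, 31, 39, 43, 47, 51, 55} : Finset (ZMod 56)) = {3, 11, 19, 27, 43, 51} ∧
      ({15, 23, 31, 39, 47, 55} : Finset (ZMod 56)) ∪ {3, 11, 19, 27, 43, 51} =
        ({3, 11, 15, 19, 23, 27, 31, 39, 43, 47, 51, 55} : Finset (ZMod 56)) ∧
      Disjoint ({15, 23, 31, 39, 47, 55} : Finset (ZMod 56)) {3, 11, 19, 27, 43, 51} ∧
      (Cp ∩ (Nodd \ ({3, 11, 15, 19, 23, 27, 31, 39, 43, 47, 51, 55} : Finset (ZMod 56)))).card = 3 ∧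
      (Cm ∩ (Nodd \ ({3, 11, 15, 19, 23, 27, 31, 39, 43, 47, 51, 55} : Finset (ZMod 56)))).card = 3) ∧
    (IsCMTypeSet 56 ({3, 5, 13, 17, 19, 27, 31, 33, 41, 45, 47, 55} : Finset (ZMod 56)) ∧
      Cp ∩ ({3, 5, 13, 17, 19, 27, 31, 33, 41, 45, 47, 55} : Finset (ZMod 56)) = {17, 31, 33, 41, 47, 55} ∧
      Cm ∩ ({3, 5, 13, 17, 19, 27, 31, 33, 41, 45, 47, 55} : Finset (ZMod 56)) = {3, 5, 13, 19, 27, 45} ∧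
      ({17, 31, 33, 41, 47, 55} : Finset (ZMod 56)) ∪ {3, 5, 13, 19, 27, 45} =
        ({3, 5, 13, 17, 19, 27, 31, 33, 41, 45, 47, 55} : Finset (ZMod 56)) ∧
      Disjoint ({17, 31, 33, 41, 47, 55} : Finset (ZMod 56)) {3, 5, 13, 19, 27, 45} ∧
      (Cp ∩ (Nodd \ ({3, 5, 13, 17, 19, 27, 31, 33, 41, 45, 47, 55} : Finset (ZMod 56)))).card = 4 ∧
      (Cm ∩ (Nodd \ ({3, 5, 13, 17, 19, 27, 31, 33, 41, 45, 47, 55} : Finset (ZMod 56)))).card = 4) ∧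
    (Finset.univ.filter fun t : ZMod 56 => t.val.Coprime 56).card = 24 := by
  refine ⟨by decide, ⟨by decide, by decide, by decide, by decide, by decide, by decide, by decide⟩,
    ⟨by decide, by decide, by decide, by decide, by decide, by decide, by decide⟩, by decide⟩

open scoped Classical in
/-- **CENSUS ROW `(56, ℚ(i))` — YES, HYPOTHESIS-FREE**: for any CM type `Φ` of a cyclotomic CM field `K ⊇ ℚ(ζ₅₆)`
balanced for `N_K = {3,11,15,19,23,27,31,39,43,47,51,55}` (the residues conjugating `i`; Weil signature `(6,6)`), if
`n₊₋(Φ) := |S_Φ ∩ {15,23,31,39,47,55}|` is ODD then `ℂ^Φ/Φ(ℤ[ζ₅₆])` CARRIES an `ι`-compatible principal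
polarisation (`λ₊ ≡ n₊₋ + 3`, `λ₋ ≡ (6 − n₊₋) + 3`, both even).  With part 37's `…fiftySix_of_even`: for
`K`-balanced `Φ`, **principal ⟺ `n₊₋(Φ)` odd** — census b01.25 (A) at `(56, ℚ(i))` in the kernel (472 YES / 452 NO).
research route conditional on HC_CM; not a corollary; Q11.4-sentence-2 already refuted in dim ≥ 3. [cite: Shimura1998, §14.3 Prop. 5, p. 104] -/
theorem exists_principal_fiftySix_sqrt_neg_one [IsCMField K] [IsCyclotomicExtension {56} ℚ K]
    (hζ : IsPrimitiveRoot ζ 56) (Φ : CMType K)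
    (hbal : 2 * ((Finset.univ.filter fun t : ZMod 56 => ∃ σ ∈ Φ.1, σ ζ = 𝐞 t) ∩
        ({3, 11, 15, 19, 23, 27, 31, 39, 43, 47, 51, 55} : Finset (ZMod 56))).card =
      (Finset.univ.filter fun t : ZMod 56 => ∃ σ ∈ Φ.1, σ ζ = 𝐞 t).card)
    (hodd : Odd (((Finset.univ.filter fun t : ZMod 56 => ∃ σ ∈ Φ.1, σ ζ = 𝐞 t) ∩
      ({15, 23, 31, 39, 47, 55} : Finset (ZMod 56))).card)) :
    ∃ ζ' : K, IsCMField.complexConj K ζ' = -ζ' ∧ (∀ φ : Φ.1, 0 < (φ.1 ζ').im) ∧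
        CMTypeLattice.IsOfType (1 : (FractionalIdeal (𝓞 K)⁰ K)ˣ) ζ' ⊤ := by
  classical
  obtain ⟨hNodd, ⟨hNK, hEp, hEm, hunion, hdisj, hdp, hdm⟩, -, hU⟩ := rowData_fiftySix
  obtain ⟨hcompl, -, hCm, hCp, -, -, -, -⟩ := classFacts_fiftySix
  have hS := isCMTypeSet_residueFilter hζ Φ
  obtain ⟨h1, h2, h3⟩ := row_parities hS hNodd hNK hcompl hCp hCm hEp hEm hunion hdisj
  have hcard : (Finset.univ.filter fun t : ZMod 56 => ∃ σ ∈ Φ.1, σ ζ = 𝐞 t).card = 12 := by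
    have := two_mul_card_eq_card_units hS; omega
  rw [hdp] at h1; rw [hdm] at h2
  rw [hcard] at hbal
  obtain ⟨j, hj⟩ := hodd
  refine exists_principal_fiftySix_of_even_on hζ Φ ?_ ?_
  · rw [Nat.even_iff]; omega
  · rw [Nat.even_iff]; omega

open scoped Classical in
/-- **CENSUS ROW `(56, ℚ(√−7))` — YES, HYPOTHESIS-FREE**: for any CM type `Φ` balanced for
`N_K = {3,5,13,17,19,27,31,33,41,45,47,55}` (the residues conjugating `√−7`), if `n₊₋(Φ) := |S_Φ ∩ {17,31,33,41,47,55}|`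
is EVEN then `ℂ^Φ/Φ(ℤ[ζ₅₆])` CARRIES an `ι`-compatible principal polarisation (`λ₊ ≡ n₊₋ + 4`,
`λ₋ ≡ (6 − n₊₋) + 4`).  With part 37's `…fiftySix_of_odd`: for `K`-balanced `Φ`, **principal ⟺ `n₊₋(Φ)` even** —
census b01.25 (A) at `(56, ℚ(√−7))` in the kernel (452 YES / 472 NO).
research route conditional on HC_CM; not a corollary; Q11.4-sentence-2 already refuted in dim ≥ 3. [cite: Shimura1998, §14.3 Prop. 5, p. 104] -/
theorem exists_principal_fiftySix_sqrt_neg_seven [IsCMField K] [IsCyclotomicExtension {56} ℚ K]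
    (hζ : IsPrimitiveRoot ζ 56) (Φ : CMType K)
    (hbal : 2 * ((Finset.univ.filter fun t : ZMod 56 => ∃ σ ∈ Φ.1, σ ζ = 𝐞 t) ∩
        ({3, 5, 13, 17, 19, 27, 31, 33, 41, 45, 47, 55} : Finset (ZMod 56))).card =
      (Finset.univ.filter fun t : ZMod 56 => ∃ σ ∈ Φ.1, σ ζ = 𝐞 t).card)
    (heven : Even (((Finset.univ.filter fun t : ZMod 56 => ∃ σ ∈ Φ.1, σ ζ = 𝐞 t) ∩
      ({17, 31, 33, 41, 47, 55} : Finset (ZMod 56))).card)) :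
    ∃ ζ' : K, IsCMField.complexConj K ζ' = -ζ' ∧ (∀ φ : Φ.1, 0 < (φ.1 ζ').im) ∧
        CMTypeLattice.IsOfType (1 : (FractionalIdeal (𝓞 K)⁰ K)ˣ) ζ' ⊤ := by
  classical
  obtain ⟨hNodd, -, ⟨hNK, hEp, hEm, hunion, hdisj, hdp, hdm⟩, hU⟩ := rowData_fiftySix
  obtain ⟨hcompl, -, hCm, hCp, -, -, -, -⟩ := classFacts_fiftySix
  have hS := isCMTypeSet_residueFilter hζ Φ
  obtain ⟨h1, h2, h3⟩ := row_parities hS hNodd hNK hcompl hCp hCm hEp hEm hunion hdisj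
  have hcard : (Finset.univ.filter fun t : ZMod 56 => ∃ σ ∈ Φ.1, σ ζ = 𝐞 t).card = 12 := by
    have := two_mul_card_eq_card_units hS; omega
  rw [hdp] at h1; rw [hdm] at h2
  rw [hcard] at hbal
  obtain ⟨j, hj⟩ := heven
  refine exists_principal_fiftySix_of_even_on hζ Φ ?_ ?_
  · rw [Nat.even_iff]; omega
  · rw [Nat.even_iff]; omega

/-- Row data at `56` for `K = ℚ(√−2)` and `K = ℚ(√−14)` (`decide`): `N_K`, `E± = C± ∩ N_K`, the constants. [folklore] -/
theorem rowData_fiftySix' :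
    (IsCMTypeSet 56 ({5, 13, 15, 23, 29, 31, 37, 39, 45, 47, 53, 55} : Finset (ZMod 56)) ∧
      Cp ∩ ({5, 13, 15, 23, 29, 31, 37, 39, 45, 47, 53, 55} : Finset (ZMod 56)) = {15, 23, 31, 39, 47, 55} ∧
      Cm ∩ ({5, 13, 15, 23, 29, 31, 37, 39, 45, 47, 53, 55} : Finset (ZMod 56)) = {5, 13, 29, 37, 45, 53} ∧
      ({15, 23, 31, 39, 47, 55} : Finset (ZMod 56)) ∪ {5, 13, 29, 37, 45, 53} =
        ({5, 13, 15, 23, 29, 31, 37, 39, 45, 47, 53, 55} : Finset (ZMod 56)) ∧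
      Disjoint ({15, 23, 31, 39, 47, 55} : Finset (ZMod 56)) {5, 13, 29, 37, 45, 53} ∧
      (Cp ∩ (Nodd \ ({5, 13, 15, 23, 29, 31, 37, 39, 45, 47, 53, 55} : Finset (ZMod 56)))).card = 3 ∧
      (Cm ∩ (Nodd \ ({5, 13, 15, 23, 29, 31, 37, 39, 45, 47, 53, 55} : Finset (ZMod 56)))).card = 3) ∧
    (IsCMTypeSet 56 ({11, 17, 29, 31, 33, 37, 41, 43, 47, 51, 53, 55} : Finset (ZMod 56)) ∧
      Cp ∩ ({11, 17, 29, 31, 33, 37, 41, 43, 47, 51, 53, 55} : Finset (ZMod 56)) = {17, 31, 33, 41, 47, 55} ∧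
      Cm ∩ ({11, 17, 29, 31, 33, 37, 41, 43, 47, 51, 53, 55} : Finset (ZMod 56)) = {11, 29, 37, 43, 51, 53} ∧
      ({17, 31, 33, 41, 47, 55} : Finset (ZMod 56)) ∪ {11, 29, 37, 43, 51, 53} =
        ({11, 17, 29, 31, 33, 37, 41, 43, 47, 51, 53, 55} : Finset (ZMod 56)) ∧
      Disjoint ({17, 31, 33, 41, 47, 55} : Finset (ZMod 56)) {11, 29, 37, 43, 51, 53} ∧
      (Cp ∩ (Nodd \ ({11, 17, 29, 31, 33, 37, 41, 43, 47, 51, 53, 55} : Finset (ZMod 56)))).card = 4 ∧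
      (Cm ∩ (Nodd \ ({11, 17, 29, 31, 33, 37, 41, 43, 47, 51, 53, 55} : Finset (ZMod 56)))).card = 2) := by
  refine ⟨⟨by decide, by decide, by decide, by decide, by decide, by decide, by decide⟩,
    ⟨by decide, by decide, by decide, by decide, by decide, by decide, by decide⟩⟩

open scoped Classical in
/-- **CENSUS ROW `(56, ℚ(√−2))` — YES, HYPOTHESIS-FREE**: for any CM type `Φ` balanced for
`N_K = {5,13,15,23,29,31,37,39,45,47,53,55}` (the residues conjugating `√−2`), `n₊₋(Φ) := |S_Φ ∩ {15,23,31,39,47,55}|`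
ODD ⇒ `ℂ^Φ/Φ(ℤ[ζ₅₆])` CARRIES an `ι`-compatible principal polarisation; with part 37: **principal ⟺ `n₊₋(Φ)` odd**
(472 YES / 452 NO).
research route conditional on HC_CM; not a corollary; Q11.4-sentence-2 already refuted in dim ≥ 3. [cite: Shimura1998, §14.3 Prop. 5, p. 104] -/
theorem exists_principal_fiftySix_sqrt_neg_two [IsCMField K] [IsCyclotomicExtension {56} ℚ K]
    (hζ : IsPrimitiveRoot ζ 56) (Φ : CMType K)
    (hbal : 2 * ((Finset.univ.filter fun t : ZMod 56 => ∃ σ ∈ Φ.1, σ ζ = 𝐞 t) ∩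
        ({5, 13, 15, 23, 29, 31, 37, 39, 45, 47, 53, 55} : Finset (ZMod 56))).card =
      (Finset.univ.filter fun t : ZMod 56 => ∃ σ ∈ Φ.1, σ ζ = 𝐞 t).card)
    (hodd : Odd (((Finset.univ.filter fun t : ZMod 56 => ∃ σ ∈ Φ.1, σ ζ = 𝐞 t) ∩
      ({15, 23, 31, 39, 47, 55} : Finset (ZMod 56))).card)) :
    ∃ ζ' : K, IsCMField.complexConj K ζ' = -ζ' ∧ (∀ φ : Φ.1, 0 < (φ.1 ζ').im) ∧
        CMTypeLattice.IsOfType (1 : (FractionalIdeal (𝓞 K)⁰ K)ˣ) ζ' ⊤ := by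
  classical
  obtain ⟨hNodd, -, -, hU⟩ := rowData_fiftySix
  obtain ⟨⟨hNK, hEp, hEm, hunion, hdisj, hdp, hdm⟩, -⟩ := rowData_fiftySix'
  obtain ⟨hcompl, -, hCm, hCp, -, -, -, -⟩ := classFacts_fiftySix
  have hS := isCMTypeSet_residueFilter hζ Φ
  obtain ⟨h1, h2, h3⟩ := row_parities hS hNodd hNK hcompl hCp hCm hEp hEm hunion hdisj
  have hcard : (Finset.univ.filter fun t : ZMod 56 => ∃ σ ∈ Φ.1, σ ζ = 𝐞 t).card = 12 := by
    have := two_mul_card_eq_card_units hS; omega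
  rw [hdp] at h1; rw [hdm] at h2
  rw [hcard] at hbal
  obtain ⟨j, hj⟩ := hodd
  refine exists_principal_fiftySix_of_even_on hζ Φ ?_ ?_
  · rw [Nat.even_iff]; omega
  · rw [Nat.even_iff]; omega

open scoped Classical in
/-- **CENSUS ROW `(56, ℚ(√−14))` — YES, HYPOTHESIS-FREE**: for any CM type `Φ` balanced for
`N_K = {11,17,29,31,33,37,41,43,47,51,53,55}` (the residues conjugating `√−14`),
`n₊₋(Φ) := |S_Φ ∩ {17,31,33,41,47,55}|` EVEN ⇒ `ℂ^Φ/Φ(ℤ[ζ₅₆])` CARRIES an `ι`-compatible principal polarisation; with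
part 37: **principal ⟺ `n₊₋(Φ)` even** (452 YES / 472 NO).
research route conditional on HC_CM; not a corollary; Q11.4-sentence-2 already refuted in dim ≥ 3. [cite: Shimura1998, §14.3 Prop. 5, p. 104] -/
theorem exists_principal_fiftySix_sqrt_neg_fourteen [IsCMField K] [IsCyclotomicExtension {56} ℚ K]
    (hζ : IsPrimitiveRoot ζ 56) (Φ : CMType K)
    (hbal : 2 * ((Finset.univ.filter fun t : ZMod 56 => ∃ σ ∈ Φ.1, σ ζ = 𝐞 t) ∩
        ({11, 17, 29, 31, 33, 37, 41, 43, 47, 51, 53, 55} : Finset (ZMod 56))).card =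
      (Finset.univ.filter fun t : ZMod 56 => ∃ σ ∈ Φ.1, σ ζ = 𝐞 t).card)
    (heven : Even (((Finset.univ.filter fun t : ZMod 56 => ∃ σ ∈ Φ.1, σ ζ = 𝐞 t) ∩
      ({17, 31, 33, 41, 47, 55} : Finset (ZMod 56))).card)) :
    ∃ ζ' : K, IsCMField.complexConj K ζ' = -ζ' ∧ (∀ φ : Φ.1, 0 < (φ.1 ζ').im) ∧
        CMTypeLattice.IsOfType (1 : (FractionalIdeal (𝓞 K)⁰ K)ˣ) ζ' ⊤ := by
  classical
  obtain ⟨hNodd, -, -, hU⟩ := rowData_fiftySix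
  obtain ⟨-, ⟨hNK, hEp, hEm, hunion, hdisj, hdp, hdm⟩⟩ := rowData_fiftySix'
  obtain ⟨hcompl, -, hCm, hCp, -, -, -, -⟩ := classFacts_fiftySix
  have hS := isCMTypeSet_residueFilter hζ Φ
  obtain ⟨h1, h2, h3⟩ := row_parities hS hNodd hNK hcompl hCp hCm hEp hEm hunion hdisj
  have hcard : (Finset.univ.filter fun t : ZMod 56 => ∃ σ ∈ Φ.1, σ ζ = 𝐞 t).card = 12 := by
    have := two_mul_card_eq_card_units hS; omega
  rw [hdp] at h1; rw [hdm] at h2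
  rw [hcard] at hbal
  obtain ⟨j, hj⟩ := heven
  refine exists_principal_fiftySix_of_even_on hζ Φ ?_ ?_
  · rw [Nat.even_iff]; omega
  · rw [Nat.even_iff]; omega

end Summit.HodgeConjecture.Ring2WeilCoverage.CyclotomicTwistedLevel56Yes

end
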